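import Mathlib
import HarnessLib

/-!
# Crux `H413`, line LH4 «(D-RAM) FOUR-FRAME», tier 2 under `U4_Rows` §2: THE SHAPE OF A UNITARY TRANSVECTION — if `M` preserves a `σ`-sesquilinear form `Φ`
# (`(σM)ᵀ Φ M = Φ`, `det Φ ≠ 0`) and `X := M − 1` satisfies `X² = 0`, `X ≠ 0`, then `X = c • v ⊗ ⟨v, ·⟩_Φ`:
# `X = c • vecMulVec v (vecMul (σ ∘ v) Φ)` with `c ≠ 0`, `v ≠ 0` (pure linear algebra over a field; the input of the value-set lemma for the transvection label)

Cell `hodgecm-mathlib` (D-0151), FLOOR 0, crux item H413 = `stmt-HodgeConjecture-24833`, route of record `HCCMUnconditional`; squad F0∕P3c∕LH4, Track A; dealer LH4-plan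
(g10) WORD #17∕#18 (U4 §2 `stub_U4_table_vanishing`, the `(label 1, f_{T−})` entry); tier-2 hand LH4-p03 (g11).  THEOREMS ONLY (no `def`, no instance, no notation, no `sorry`,
default heartbeats); Mathlib only; lane `--supports stmt-HodgeConjecture-24833 --as helper`.

THE MATHEMATICS (elementary).  (1) SKEW-ADJOINTNESS: with `A := (σX)ᵀΦ`, `B := ΦX`, unitarity of `M = 1 + X` reads `A + B + A·X = 0`; multiplying by `1 − X` on the right
and using `X² = 0` (so `B·X = Φ·X² = 0`) gives **`(σX)ᵀ Φ = −Φ X`**.  (2) RANK ONE: `X² = 0` puts `range X ⊆ ker X`, so `rank X + rank X ≤ rank X + null X = 3`, `rank X ≤ 1`;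
with `X ≠ 0` the range is a line `K·v` (`v` = a non-zero column of `X`), and reading coefficients along a non-zero coordinate `i₀` of `v` gives the explicit factorisation
`X = vecMulVec v r`, `r = (v i₀)⁻¹ • X i₀` (a row of `X`).  (3) THE ROW IS `⟨v, ·⟩`: with `w := vecMul (σ ∘ v) Φ` (the covector `y ↦ ⟨v, y⟩_Φ`; `w ≠ 0` as `det Φ ≠ 0`),
skew-adjointness of `v ⊗ r` reads `σ(r_i)·w_k = −(Φv)_i·r_k`; at an `i₀` with `(Φv)_{i₀} ≠ 0` this gives `r = c • w`, `c = −σ(r_{i₀})∕(Φv)_{i₀}`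
constant (no symmetry of `Φ` needed).  Hence **`X = c • vecMulVec v (vecMul (σ ∘ v) Φ)`**, `c ≠ 0`, `v ≠ 0`; consequently `⟨y, X y⟩_Φ = c·⟨v,y⟩·⟨y,v⟩` — for an involutive `σ` and
hermitian-symmetric pairing this is `c·N(⟨v, y⟩)`, a NORM times a constant: the value set of a unitary transvection is `c·N(⟨v, 𝒪³⟩)` (next file).

* §1 `transpose_map_mul_eq_neg` — skew-adjointness (1).
* §2 `exists_vecMulVec_of_mul_self_eq_zero` — the rank-one factorisation (2) for ANY `3 × 3` matrix with `X² = 0`, `X ≠ 0`.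
* §3 **`exists_eq_smul_vecMulVec_pairing`** — the shape theorem (3).

HONEST LABEL.  Count-neutral helper (no stub paid).  (D-RAM) verdict of record PRINT [LanglandsShelstad1989 Thm. p. 484 ∕ Rogawski1990 Prop. 4.9.1 (a)] ∕ XL; `HC_CM` is
proved only modulo the 7 printed citations (2 remaining: hLiu418 = `stmt-HodgeConjecture-24832`, h413 = `stmt-HodgeConjecture-24833`) until rung 0 closes.
-/

namespace Summit.HodgeConjecture.HodgeConjecture.Cruxes.H413.F0P3cDyRamUnitaryTransvectionShape

open Matrix

variable {K : Type*} [Field K]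

/-! ## §1  Skew-adjointness of a unitary transvection -/

/-- **`(σX)ᵀ Φ = −Φ X`** for `X := M − 1` with `(σM)ᵀ Φ M = Φ` and `X² = 0`. -/
theorem transpose_map_mul_eq_neg (σ : K →+* K) (Φ M : Matrix (Fin 3) (Fin 3) K)
    (hM : (M.map σ)ᵀ * Φ * M = Φ) (hX : (M - 1) * (M - 1) = 0) :
    ((M - 1).map σ)ᵀ * Φ = -(Φ * (M - 1)) := by
  set X := M - 1 with hXdef
  have hMX : M = 1 + X := by rw [hXdef, add_sub_cancel]
  -- unitarity in terms of `X`: `A + B + A X = 0` with `A = (σX)ᵀΦ`, `B = ΦX`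
  have hσ1 : ((1 + X).map σ)ᵀ = 1 + (X.map σ)ᵀ := by
    rw [Matrix.map_add σ (map_add σ), Matrix.transpose_add, Matrix.map_one σ (map_zero σ) (map_one σ), Matrix.transpose_one]
  rw [hMX, hσ1] at hM
  have key : (X.map σ)ᵀ * Φ + Φ * X + (X.map σ)ᵀ * Φ * X = 0 := by
    have h := hM
    rw [Matrix.add_mul, Matrix.add_mul, Matrix.one_mul, Matrix.mul_add, Matrix.mul_add, Matrix.mul_one, Matrix.mul_one] at h
    -- h : Φ + Φ X + ((σX)ᵀΦ + (σX)ᵀΦ X) = Φ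
    have h' := congrArg (fun Z => Z - Φ) h
    simp only [sub_self] at h'
    rw [← h']
    abel
  -- multiply by `(1 − X)` on the right: `B·X = Φ·X² = 0`, `A·X·X = 0`, so `A + B = 0`
  have hBX : Φ * X * X = 0 := by rw [Matrix.mul_assoc, hX, Matrix.mul_zero]
  have e1 : ((X.map σ)ᵀ * Φ + Φ * X + (X.map σ)ᵀ * Φ * X) * (1 - X) = 0 := by rw [key, Matrix.zero_mul]
  have e2 : ((X.map σ)ᵀ * Φ + Φ * X + (X.map σ)ᵀ * Φ * X) * (1 - X) = (X.map σ)ᵀ * Φ + Φ * X := by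
    rw [Matrix.mul_sub, Matrix.mul_one, Matrix.add_mul, Matrix.add_mul, hBX, Matrix.mul_assoc ((X.map σ)ᵀ * Φ) X X, hX, Matrix.mul_zero,
      add_zero, add_zero, add_sub_cancel_right]
  rw [e2] at e1
  exact eq_neg_of_add_eq_zero_left e1

/-! ## §2  Rank one: `X² = 0`, `X ≠ 0` on `K³` ⇒ `X = v ⊗ r` explicitly -/

/-- **RANK-ONE FACTORISATION**: a `3 × 3` matrix `X` over a field with `X·X = 0` and `X ≠ 0` is `vecMulVec v r` with `v ≠ 0` a COLUMN of `X` and `r` a scaled ROW of `X`. -/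
theorem exists_vecMulVec_of_mul_self_eq_zero (X : Matrix (Fin 3) (Fin 3) K) (hX : X * X = 0) (hX0 : X ≠ 0) :
    ∃ (v r : Fin 3 → K), v ≠ 0 ∧ r ≠ 0 ∧ X = vecMulVec v r := by
  -- the linear map and `range ≤ ker`
  let f : (Fin 3 → K) →ₗ[K] (Fin 3 → K) := X.mulVecLin
  have hff : f.comp f = 0 := by
    apply LinearMap.ext
    intro y
    simp only [LinearMap.comp_apply, Matrix.mulVecLin_apply, Matrix.mulVec_mulVec, hX, Matrix.zero_mulVec, LinearMap.zero_apply, f]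
  have hrk : LinearMap.range f ≤ LinearMap.ker f := LinearMap.range_le_ker_iff.2 hff
  have hsum := LinearMap.finrank_range_add_finrank_ker f
  rw [Module.finrank_fin_fun] at hsum
  have hmono := Submodule.finrank_mono hrk
  have hr1 : Module.finrank K (LinearMap.range f) ≤ 1 := by omega
  -- a non-zero column `v = X e_{j₀}`
  obtain ⟨i₁, j₀, hij⟩ : ∃ i j, X i j ≠ 0 := by
    by_contra h
    push Not at h
    exact hX0 (Matrix.ext fun i j => by rw [h i j, Matrix.zero_apply])
  set v : Fin 3 → K := fun i => X i j₀ with hv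
  have hvf : v = f (Pi.single j₀ 1) := by
    ext i
    simp only [Matrix.mulVecLin_apply, Matrix.mulVec_single, hv, f, MulOpposite.op_one, one_smul]
    rfl
  have hv0 : v ≠ 0 := fun h => hij (by have := congrFun h i₁; simpa [hv] using this)
  have hvmem : v ∈ LinearMap.range f := ⟨_, hvf.symm⟩
  -- the range is the line through `v`
  have hline : ∀ y : Fin 3 → K, ∃ a : K, a • v = f y := by
    intro y
    have hfy : f y ∈ LinearMap.range f := LinearMap.mem_range_self f y
    have h1 : Module.finrank K (LinearMap.range f) = 1 := by
      have hpos : 0 < Module.finrank K (LinearMap.range f) := by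
        rw [Module.finrank_pos_iff_exists_ne_zero]
        exact ⟨⟨v, hvmem⟩, fun h => hv0 (congrArg Subtype.val h)⟩
      omega
    obtain ⟨a, ha⟩ := (finrank_eq_one_iff_of_nonzero' (⟨v, hvmem⟩ : LinearMap.range f) (fun h => hv0 (congrArg Subtype.val h))).1 h1 ⟨f y, hfy⟩
    exact ⟨a, by simpa using congrArg Subtype.val ha⟩
  -- read the coefficient along a non-zero coordinate `i₀` of `v`
  obtain ⟨i₀, hi₀⟩ : ∃ i, v i ≠ 0 := by
    by_contra h
    push Not at h
    exact hv0 (funext h)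
  refine ⟨v, fun j => (v i₀)⁻¹ * X i₀ j, hv0, ?_, ?_⟩
  · intro hr
    have := congrFun hr j₀
    simp only [Pi.zero_apply, mul_eq_zero, inv_eq_zero] at this
    rcases this with h | h
    · exact hi₀ h
    · exact hi₀ (by rw [hv]; exact h)
  · ext i j
    obtain ⟨a, ha⟩ := hline (Pi.single j 1)
    have hcol : ∀ i', X i' j = a * v i' := by
      intro i'
      have := congrFun ha i'
      simp only [Pi.smul_apply, smul_eq_mul, Matrix.mulVecLin_apply, Matrix.mulVec_single, MulOpposite.op_one, one_smul, f] at this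
      exact this.symm
    rw [Matrix.vecMulVec_apply, hcol i, hcol i₀]
    field_simp

/-! ## §3  The row is `⟨v, ·⟩_Φ`: the shape of a unitary transvection -/

/-- **THE SHAPE OF A UNITARY TRANSVECTION.**  Let `det Φ ≠ 0`, `M` with `(σM)ᵀ Φ M = Φ`, and `X := M − 1` with `X·X = 0`, `X ≠ 0` (no symmetry of `Φ` and no
property of `σ` beyond being a ring map are needed).  Then `X = c • vecMulVec v (vecMul (σ ∘ v) Φ)` for some `c ≠ 0` and `v ≠ 0` — i.e. `X y = c·⟨v, y⟩_Φ·v` with `⟨v, y⟩_Φ = Σ σ(v_i) Φ_{ij} y_j`. -/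
theorem exists_eq_smul_vecMulVec_pairing (σ : K →+* K) (Φ M : Matrix (Fin 3) (Fin 3) K)
    (hΦ : Φ.det ≠ 0)
    (hM : (M.map σ)ᵀ * Φ * M = Φ) (hX : (M - 1) * (M - 1) = 0) (hX0 : M - 1 ≠ 0) :
    ∃ (c : K) (v : Fin 3 → K), c ≠ 0 ∧ v ≠ 0 ∧ M - 1 = c • vecMulVec v (vecMul (σ ∘ v) Φ) := by
  obtain ⟨v, r, hv0, hr0, hXvr⟩ := exists_vecMulVec_of_mul_self_eq_zero (M - 1) hX hX0
  have hskew := transpose_map_mul_eq_neg σ Φ M hM hX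
  set w : Fin 3 → K := vecMul (σ ∘ v) Φ with hw
  -- `w ≠ 0` (`σ ∘ v ≠ 0`, `det Φ ≠ 0`)
  have hσv0 : (σ ∘ v) ≠ 0 := by
    intro h
    apply hv0
    funext i
    have := congrFun h i
    simp only [Function.comp_apply, Pi.zero_apply, map_eq_zero] at this
    exact this
  have hw0 : w ≠ 0 := fun h => hσv0 (Matrix.eq_zero_of_vecMul_eq_zero hΦ h)
  -- skew-adjointness entrywise: `σ(r i) * w k = -(Φ v)_i * r k`, and `(Φ.map σ) v`-bookkeeping
  have hent : ∀ i k, σ (r i) * w k = -((Φ.mulVec v) i * r k) := by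
    intro i k
    have h := congrFun (congrFun hskew i) k
    rw [hXvr] at h
    simp only [Matrix.mul_apply, Matrix.transpose_apply, Matrix.map_apply, Matrix.vecMulVec_apply, map_mul, Matrix.neg_apply] at h
    -- left: Σ_j σ(v j) σ(r i) Φ j k = σ(r i) * w k ; right: -(Σ_j Φ i j * (v j * r k))
    have hl : (∑ j, σ (v j) * σ (r i) * Φ j k) = σ (r i) * w k := by
      rw [hw, Matrix.vecMul, dotProduct, Finset.mul_sum]
      refine Finset.sum_congr rfl fun j _ => ?_
      simp only [Function.comp_apply]
      ring
    have hr' : (∑ j, Φ i j * (v j * r k)) = (Φ.mulVec v) i * r k := by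
      rw [Matrix.mulVec, dotProduct, Finset.sum_mul]
      refine Finset.sum_congr rfl fun j _ => by ring
    rw [hl, hr'] at h
    exact h
  -- `(Φ v)_i = σ(w i)`? No σ needed: Φ symmetric σ-fixed gives `(Φ v)_i`'s partner; we only need ONE index `k₀` with `w k₀ ≠ 0`
  obtain ⟨k₀, hk₀⟩ : ∃ k, w k ≠ 0 := by
    by_contra h
    push Not at h
    exact hw0 (funext h)
  -- from `hent i k₀`: `σ (r i) = -(Φ v)_i * r k₀ / w k₀`; from `hent i₀' k` symmetric use we instead solve for `r k` directly:
  -- take `i` with `(Φ v)_i ≠ 0`: exists since `Φ v ≠ 0`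
  have hΦv0 : Φ.mulVec v ≠ 0 := fun h => hv0 (Matrix.eq_zero_of_mulVec_eq_zero hΦ h)
  obtain ⟨i₀, hi₀⟩ : ∃ i, (Φ.mulVec v) i ≠ 0 := by
    by_contra h
    push Not at h
    exact hΦv0 (funext h)
  -- `r k = -(σ (r i₀) / (Φ v)_{i₀}) * w k` for all `k`
  set c : K := -(σ (r i₀) / (Φ.mulVec v) i₀) with hc
  have hrk : ∀ k, r k = c * w k := by
    intro k
    have h := hent i₀ k
    rw [hc]
    field_simp
    linear_combination h
  refine ⟨c, v, ?_, hv0, ?_⟩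
  · intro hc0
    apply hr0
    funext k
    rw [hrk k, hc0, zero_mul]
    rfl
  · rw [hXvr]
    ext i k
    simp only [Matrix.vecMulVec_apply, Matrix.smul_apply, smul_eq_mul, hrk k]
    ring

end Summit.HodgeConjecture.HodgeConjecture.Cruxes.H413.F0P3cDyRamUnitaryTransvectionShape
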